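import Summits.QuantumFields.BalabanUV.Beta.FP.CubicGermFunctional
import Summits.QuantumFields.BalabanUV.Beta.FP.GhostCubicGerm
import Summits.QuantumFields.BalabanUV.Beta.FP.PolarizationColour

/-!
# `BalabanUV.Beta.FP.PolarizationGermBubble` — road «FP» for binder row D1, leaf (H2), row **H2-ASM-3** (KERNEL BUBBLE ⟹ GERM BUBBLE), FILE 1 of 2 =
# THE GERM HALF: the leading term of the one-loop bubble's double-smear expansion, read on Kronecker ∕ continuum legs, IS `cL²·bubbleCrossed L L` of the
# cubic germ `L = cubicGermOf V`; by Bose it is `−(cL²∕2)·bubble L L`, so the germ of `hessKer`'s `−½·bubble` is `cL²·(¼·bubble L L)` — the letter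
# `aB = ¼` of `FP/PolarizationColour`; ghost twin `aG = −½`; and the MOMENT DICTIONARY (the expansion's four first moments are `cubicGermOf` entries)

HONEST DEPENDENCY (page 1, mandatory): continuum YM on T⁴ ⇐ BetaPertH ∧ nine spine estimates (0/9 proved); BetaPertH ⇐ (D1) ∧ (D4) ∧ CAP+tail;
G-an2-4 gates asym, D1 and NE2/3/4.  HONEST FRAMING (cell contract, verbatim): «discharging `BetaPertH` makes Bałaban's UV stability UNCONDITIONAL —
a real constructive-QFT result; it is NOT the continuum limit and NOT the Clay problem.»  THIS MODULE DISCHARGES NOTHING of the wall: it is [folklore]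
FINITE ALGEBRA over `Fin 4` ∕ `Fin 2` on t4-ne9-formalise-leaf-03's germ bubble (`FP/BubbleGermValue`: `bubbleCrossed`, `bubble`, `ghostLoop`, `legWx`) plus two
`tsum` re-indexings on `ℤ⁴ × ℤ⁴`; three [our object] data definitions (`leadGerm`, `loopSc`, `leadGermSc`) that only NAME explicit finite sums; no lattice estimate,
no limit; 0 `def … : Prop`, nothing cited, 0 sorry; 0∕4 row-D1 binders; NOT the row's END (FILE 2 `FP/PolarizationGerm`), NOT `hgerm`, NOT D1, NOT BetaPertH, NOT
continuum, NOT Clay.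

ABSOLUTE RULE (cell charter, verbatim): «No internally-minted statement may enter as a cited fact. Every hypothesis is either kernel-proved in this package or a
verbatim quotation of a PUBLISHED theorem with page reference. The manuscript(s) under audit are NOT citable for their own disputed steps — they are the thing
under adjudication; programme-internal (2001/route/tribunal) claims are never citable.»  Every statement below is an identity of explicit sums.

THE ROW (owner memo `HOME/b2b-balaban-beta-d1-p3/H2V-DESIGN.md` f78878bd5f8d2d18 §4, R-FP-23; `LEAVES-FP.md` l.324): «admissible `V` + H2-ASM-2 legs ⟹
`−½·bubble Pker (V μ 0)(V ν z) = c₄′²·𝔅[cubicGermOf V](μ,ν; toReal z) + O((‖z‖+1)⁻⁷)`, `𝔅` = the germ-level bubble functional (`BubbleGermValue.bubble L L` up to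
the antisymmetrisation factor DISPLAYED here — ¼ and the channel signs pinned in THIS row); ghost twin; tadpoles».  The kernel-level expansion is the H2-ASM-1
engine (beta-d1-formalise-leaf-02: `FP/ExpLocalisedBubbleOrder2{,Point}` ✓, parts 3∕A∕B∕C, the END part D `ExpLocalisedBubbleKernel.abs_bubble_kernel_sub_lead_le`
and the bridge `FP/BubbleSmearBridge` in flight): for a bounded translation-invariant leg `A` and two zero-mass bi-localised vertices `V₀` (at `(0,0)`), `V₁`
(at `(z,z)`) it gives `bubble A V₀ V₁ = Σ_{a f g h} Lead_{afgh}(z) + O((‖z‖∞+1)^{−(a+b+3)})` with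
  `Lead_{afgh}(z) = −Σ_{i j} [ M₀¹_i(g,f)·M₁¹_j(h,a)·(A 0 z f h · Δ_iΔ_jF_{ag}(z)) + M₀¹_i·M₁²_j·(Δ_iF_{ag}·Δ_jG_{fh})(z) + M₀²_i·M₁¹_j·(Δ_jF_{ag}·Δ_iG_{fh})(z)
                   + M₀²_i·M₁²_j·(A 0 (−z) a g · Δ_iΔ_jG_{fh}(z)) ]`,
  `F_{ag} v = A 0 (−v) a g`, `G_{fh} v = A 0 v f h`, `M₀¹_i(g,f) = Σ'_p V₀ p.1 p.2 g f·p.1_i`, `M₀²_i` idem with `p.2_i`, `M₁¹_j(h,a) = Σ'_p V₁ (z+p.2) (z+p.1) h a·p.1_j`,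
  `M₁²_j` idem with `p.2_j`.
THIS FILE supplies the two finite-algebra facts that turn `Σ Lead` into the germ bubble once (FILE 2) the legs are replaced by their continuum germs
`A 0 v (inl α)(inl β) ↦ cL·δ_{αβ}·ℓ₀(v)`, `Δ_i ↦ ∂_i` (`BubbleTransfer.invSq ∕ d1InvSq ∕ hessInvSq`; for `Pker`, `cL = c₄′·c₄` by H2-P-KER (K0), H2-ASM-2's dictionary):
* §1 THE MOMENT DICTIONARY [folklore]: for a first-order family `V : Fin 4 → ℤ⁴ → MKer 4 (Fib 3)`, `M₀¹_κ(inl g, inl f) = cubicGermOf V g f μ κ 0` and `M₀²_κ = … κ 1` for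
  `V₀ := V μ 0` (`tsum_fst_moment`, `tsum_snd_moment` — definitional); under the translation-covariance letter (a2) `V λ v = shiftK (−v) (V λ 0)` (H2V-DESIGN §2, the shape
  of `AdmissibleCubicGerm`'s `hcov`) the RECENTRED moments of `V₁ := V ν z` are the germ entries WITH THE TWO LEGS SWAPPED: `M₁¹_κ(inl h, inl a) = cubicGermOf V h a ν κ 1`,
  `M₁²_κ = … κ 0` (`tsum_recentred_fst_moment`, `tsum_recentred_snd_moment`; `Equiv.prodComm` re-indexing, no summability needed); scalar-fibre twins for
  `cubicGermOfSc` (`GhostCubicGerm`).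
* §2 THE GERM OF THE LEAD [our object + folklore]: `leadGerm cL L μ ν x` := `Σ Lead` with Kronecker∕continuum legs and the fibre sums collapsed (`h = f`, `a = g`: the SECOND
  germ enters with its quantum legs SWAPPED, `L f g ν · ·`); **`leadGerm_eq_crossed : leadGerm cL L μ ν x = cL²·bubbleCrossed L L μ ν x`** — the kernel trace
  `tr((A∘V₀)(A∘V₁))` is ONE cyclic Wick pattern = the CROSSED channel, and `legWx`'s placements («both derivatives on one line iff the momentum labels differ») are
  exactly the four Taylor placements; BOSE (`bubbleCrossed_eq_neg_direct`): **`leadGerm_eq_bubble (Anti12 L) : leadGerm cL L μ ν x = −(cL²∕2)·bubble L L μ ν x`**, hence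
  **`half_leadGerm : −½·leadGerm cL L μ ν x = cL²·(¼·bubble L L μ ν x)` — THE LETTER `aB = ¼`** (channel sign `+`).  Ghost: `loopSc l` (the crossed-weight loop of a scalar
  germ; `loopSc ghostGerm = ghostLoop` by `rfl`), `leadGermSc cG l`, **`leadGermSc_eq_loop : leadGermSc cG l λ λ′ x = cG²·loopSc l λ λ′ x`**, hence
  **`half_leadGermSc_ghost : −½·leadGermSc cG ghostGerm λ λ′ x = cG²·(−½·ghostLoop λ λ′ x)` — THE LETTER `aG = −½`**.
* §3 INSTANCES [folklore]: `half_leadGerm_fam` (`L = famGerm cQ s`, Bose by `famGerm_anti12`), `half_leadGerm_smul_bfGerm` (`L = cQ • bfGerm`, the face of H2-ASM-4),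
  `half_leadGerm_bfGerm : −½·leadGerm cL bfGerm λ λ′ x = cL²·gluonBubble λ λ′ x` (`x ≠ 0`; `quarter_bubble_bfGerm`), `half_leadGermSc_ghost' : … = −(cG²∕2)·ghostBubble`
  (`ghostLoop_eq`); THE JUNCTION WITH H2-ASM-4 at `(aB, aG) = (¼, −½)`: `germFace_eq` (the germ-level polarization `wg·(−½·leadGerm cL (cQ•bfGerm)) − wgh·(−½·leadGermSc cG
  ghostGerm)` IS `PolarizationColour`'s face), `germFace_eq_transverse` (`= (10·wg·(cL·cQ)² + wgh·cG²∕2)∕3 · T`, `germPol_eq`), and `weights_quarter_half` (sector matching at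
  canonical legs ⟺ `wg = 2N²`, `wgh = 4N²` — `weights_canonical`, a DISPLAY of what the letters imply, nothing asserted about an3's dictionary).
WHAT IT IS NOT: no kernel, no remainder, no `Pker` — the END `|−½·bubble Pker (V μ 0)(V ν z) − (−½)·leadGerm cL (cubicGermOf V) μ ν (toReal z)| ≤ C″∕(‖z‖∞+1)⁷` (+ ghost,
+ tadpole under the quartic table's joint-localisation letter, `D1BFx.ContactCount.abs_tadpole_le_of_entryBound` BY NAME) is FILE 2 `FP/PolarizationGerm`, after the engine's
part D, the bridge and H2-ASM-2's `PerfectPropagatorLegData` land.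
Provenance: G-an2-4 formalisation swarm seat b2b-balaban-gan24-formalise-leaf-02 gen 39 (cross-lane on road FP; row H2-ASM-3, journal INTENT ∕ CLAIM 2026-08-21T02:59:29Z), 2026-08-21.
-/

noncomputable section

namespace Summit.QuantumFields.BalabanUV.Beta.FP.PolarizationGermBubble

open Finset
open scoped BigOperators
open Literature.MathematicalPhysics.QuantumFieldTheory.Balaban1983to89
open Literature.MathematicalPhysics.QuantumFieldTheory.Balaban1983to89.Beta
open Literature.MathematicalPhysics.QuantumFieldTheory.Balaban1983to89.Beta.TransverseStructure
open Literature.MathematicalPhysics.QuantumFieldTheory.Balaban1983to89.Beta.BubbleTransfer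
open Literature.MathematicalPhysics.QuantumFieldTheory.Balaban1983to89.Beta.LeadingCoefficient
open ExpKernelCalculus (Site MKer shiftK)
open OneStepResolventKernel (Fib)
open Summit.QuantumFields.BalabanUV.Beta.FP.MarginalUniqueness (Idx CubicGerm δ Anti12 ymGerm)
open Summit.QuantumFields.BalabanUV.Beta.FP.BubbleGermValue
open Summit.QuantumFields.BalabanUV.Beta.FP.PolarizationColour (germPol_eq weights_canonical)
open Summit.QuantumFields.BalabanUV.Beta.FP.WilsonCubicGerm (cubicGermOf)
open Summit.QuantumFields.BalabanUV.Beta.FP.GhostCubicGerm (cubicGermOfSc)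

/-! ## §1 The moment dictionary: the expansion's first moments are cubic-germ entries -/

section Moments

variable {V : Fin 4 → Site 4 → MKer 4 (Fib 3)} {v : Fin 4 → Site 4 → MKer 4 Unit}

/-- [folklore] FIRST-SLOT moment of the member at background bond `(μ, 0)`, field block: `Σ'_p V μ 0 p.1 p.2 (inl g)(inl f)·p.1_κ = cubicGermOf V g f μ κ 0` (definitional). -/
theorem tsum_fst_moment (μ κ g f : Fin 4) :
    ∑' p : Site 4 × Site 4, V μ 0 p.1 p.2 (Sum.inl g) (Sum.inl f) * (p.1 κ : ℝ) = cubicGermOf V g f μ κ 0 := by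
  unfold cubicGermOf
  simp

/-- [folklore] SECOND-SLOT moment of the member at `(μ, 0)`, field block: `Σ'_p V μ 0 p.1 p.2 (inl g)(inl f)·p.2_κ = cubicGermOf V g f μ κ 1`. -/
theorem tsum_snd_moment (μ κ g f : Fin 4) :
    ∑' p : Site 4 × Site 4, V μ 0 p.1 p.2 (Sum.inl g) (Sum.inl f) * (p.2 κ : ℝ) = cubicGermOf V g f μ κ 1 := by
  unfold cubicGermOf
  simp

/-- [folklore] under (a2) the member at `(ν, z)` read in recentred coordinates is the member at `(ν, 0)`: `V ν z (z + x) (z + y) = V ν 0 x y`. -/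
theorem recentre_of_cov (hcov : ∀ (lam : Fin 4) (w : Site 4), V lam w = shiftK (-w) (V lam 0)) (ν : Fin 4) (z x y : Site 4) :
    V ν z (z + x) (z + y) = V ν 0 x y := by
  rw [hcov ν z]
  simp [shiftK]

/-- [folklore] **RECENTRED FIRST-SLOT MOMENT = SECOND-LEG GERM ENTRY** (the recentring `(z + p.2, z + p.1)` of the engine swaps the two slots): under (a2),
`Σ'_p V ν z (z+p.2) (z+p.1) (inl h)(inl a)·p.1_κ = cubicGermOf V h a ν κ 1`. -/
theorem tsum_recentred_fst_moment (hcov : ∀ (lam : Fin 4) (w : Site 4), V lam w = shiftK (-w) (V lam 0)) (ν : Fin 4) (z : Site 4) (κ h a : Fin 4) :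
    ∑' p : Site 4 × Site 4, V ν z (z + p.2) (z + p.1) (Sum.inl h) (Sum.inl a) * (p.1 κ : ℝ) = cubicGermOf V h a ν κ 1 := by
  simp_rw [recentre_of_cov hcov]
  unfold cubicGermOf
  rw [← (Equiv.prodComm (Site 4) (Site 4)).tsum_eq]
  simp

/-- [folklore] **RECENTRED SECOND-SLOT MOMENT = FIRST-LEG GERM ENTRY**: under (a2), `Σ'_p V ν z (z+p.2) (z+p.1) (inl h)(inl a)·p.2_κ = cubicGermOf V h a ν κ 0`. -/
theorem tsum_recentred_snd_moment (hcov : ∀ (lam : Fin 4) (w : Site 4), V lam w = shiftK (-w) (V lam 0)) (ν : Fin 4) (z : Site 4) (κ h a : Fin 4) :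
    ∑' p : Site 4 × Site 4, V ν z (z + p.2) (z + p.1) (Sum.inl h) (Sum.inl a) * (p.2 κ : ℝ) = cubicGermOf V h a ν κ 0 := by
  simp_rw [recentre_of_cov hcov]
  unfold cubicGermOf
  rw [← (Equiv.prodComm (Site 4) (Site 4)).tsum_eq]
  simp

/-- [folklore] scalar-fibre twin of `tsum_fst_moment` (`GhostCubicGerm.cubicGermOfSc`). -/
theorem tsum_fst_moment_sc (μ κ : Fin 4) :
    ∑' p : Site 4 × Site 4, v μ 0 p.1 p.2 () () * (p.1 κ : ℝ) = cubicGermOfSc v μ κ 0 := by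
  unfold cubicGermOfSc
  simp

/-- [folklore] scalar-fibre twin of `tsum_snd_moment`. -/
theorem tsum_snd_moment_sc (μ κ : Fin 4) :
    ∑' p : Site 4 × Site 4, v μ 0 p.1 p.2 () () * (p.2 κ : ℝ) = cubicGermOfSc v μ κ 1 := by
  unfold cubicGermOfSc
  simp

/-- [folklore] scalar-fibre twin of `recentre_of_cov`. -/
theorem recentre_of_cov_sc (hcov : ∀ (lam : Fin 4) (w : Site 4), v lam w = shiftK (-w) (v lam 0)) (ν : Fin 4) (z x y : Site 4) :
    v ν z (z + x) (z + y) = v ν 0 x y := by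
  rw [hcov ν z]
  simp [shiftK]

/-- [folklore] scalar-fibre twin of `tsum_recentred_fst_moment`. -/
theorem tsum_recentred_fst_moment_sc (hcov : ∀ (lam : Fin 4) (w : Site 4), v lam w = shiftK (-w) (v lam 0)) (ν : Fin 4) (z : Site 4) (κ : Fin 4) :
    ∑' p : Site 4 × Site 4, v ν z (z + p.2) (z + p.1) () () * (p.1 κ : ℝ) = cubicGermOfSc v ν κ 1 := by
  simp_rw [recentre_of_cov_sc hcov]
  unfold cubicGermOfSc
  rw [← (Equiv.prodComm (Site 4) (Site 4)).tsum_eq]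
  simp

/-- [folklore] scalar-fibre twin of `tsum_recentred_snd_moment`. -/
theorem tsum_recentred_snd_moment_sc (hcov : ∀ (lam : Fin 4) (w : Site 4), v lam w = shiftK (-w) (v lam 0)) (ν : Fin 4) (z : Site 4) (κ : Fin 4) :
    ∑' p : Site 4 × Site 4, v ν z (z + p.2) (z + p.1) () () * (p.2 κ : ℝ) = cubicGermOfSc v ν κ 0 := by
  simp_rw [recentre_of_cov_sc hcov]
  unfold cubicGermOfSc
  rw [← (Equiv.prodComm (Site 4) (Site 4)).tsum_eq]
  simp

end Moments

/-! ## §2 The germ of the leading term: crossed channel, Bose, the letters `aB = ¼` and `aG = −½` -/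

section Germ

/-- [our object] **THE GERM OF THE ENGINE'S LEADING TERM** for a cubic germ `L` and a leg constant `cL`: the four Taylor placements of the double-smear expansion with the
legs replaced by their Kronecker∕continuum germs (`A 0 v (inl α)(inl β) ↦ cL·δ_{αβ}·ℓ₀(v)`, `Δ_κ ↦ ∂_κ`: `invSq`, `d1InvSq`, `hessInvSq`) and the fibre sums collapsed by the two
Kroneckers (`h = f`, `a = g`), the moments read through §1 (`M₀¹_κ(g,f) = L g f μ κ 0`, `M₀²_κ = L g f μ κ 1`, `M₁¹_κ(f,g) = L f g ν κ 1`, `M₁²_κ = L f g ν κ 0`):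
`leadGerm cL L μ ν x = Σ_{g f} −Σ_{κ κ′} [ L_{gfμκ0}·L_{fgνκ′1}·(cL ℓ₀)(cL ∂_κ∂_{κ′}ℓ₀) + L_{gfμκ0}·L_{fgνκ′0}·(cL∂_κℓ₀)(cL∂_{κ′}ℓ₀) + L_{gfμκ1}·L_{fgνκ′1}·(cL∂_{κ′}ℓ₀)(cL∂_κℓ₀)
+ L_{gfμκ1}·L_{fgνκ′0}·(cL ℓ₀)(cL∂_κ∂_{κ′}ℓ₀) ](x)`.  A definition asserting nothing. -/
def leadGerm (cL : ℝ) (L : CubicGerm) (μ ν : Idx) (x : E4) : ℝ :=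
  ∑ g : Idx, ∑ f : Idx, -(∑ κ : Idx, ∑ κ' : Idx,
    (L g f μ κ 0 * L f g ν κ' 1 * ((cL * invSq x) * (cL * hessInvSq κ κ' x))
      + L g f μ κ 0 * L f g ν κ' 0 * ((cL * d1InvSq κ x) * (cL * d1InvSq κ' x))
      + L g f μ κ 1 * L f g ν κ' 1 * ((cL * d1InvSq κ' x) * (cL * d1InvSq κ x))
      + L g f μ κ 1 * L f g ν κ' 0 * ((cL * invSq x) * (cL * hessInvSq κ κ' x))))

/-- [our object] crossed leg weight, equal labels `(0,0)`: one derivative on each line. -/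
theorem legWx_00 (x : E4) (κ κ' : Idx) : legWx x 0 0 κ κ' = -(d1InvSq κ x * d1InvSq κ' x) := by simp [legWx]

/-- [our object] crossed leg weight, equal labels `(1,1)`. -/
theorem legWx_11 (x : E4) (κ κ' : Idx) : legWx x 1 1 κ κ' = -(d1InvSq κ x * d1InvSq κ' x) := by simp [legWx]

/-- [our object] crossed leg weight, different labels `(0,1)`: both derivatives on one line. -/
theorem legWx_01 (x : E4) (κ κ' : Idx) : legWx x 0 1 κ κ' = -(invSq x * hessInvSq κ κ' x) := by simp [legWx]

/-- [our object] crossed leg weight, different labels `(1,0)`. -/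
theorem legWx_10 (x : E4) (κ κ' : Idx) : legWx x 1 0 κ κ' = -(invSq x * hessInvSq κ κ' x) := by simp [legWx]

/-- [folklore] reordering of a fourfold finite sum: `Σ_a Σ_b Σ_c Σ_d = Σ_c Σ_d Σ_a Σ_b`. -/
theorem sum_comm₄ {α β γ η : Type*} [Fintype α] [Fintype β] [Fintype γ] [Fintype η] (Φ : α → β → γ → η → ℝ) :
    ∑ a, ∑ b, ∑ c, ∑ d, Φ a b c d = ∑ c, ∑ d, ∑ a, ∑ b, Φ a b c d := by
  calc ∑ a, ∑ b, ∑ c, ∑ d, Φ a b c d = ∑ a, ∑ c, ∑ d, ∑ b, Φ a b c d := by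
        refine Finset.sum_congr rfl fun a _ => ?_
        rw [Finset.sum_comm]
        refine Finset.sum_congr rfl fun c _ => ?_
        rw [Finset.sum_comm]
    _ = ∑ c, ∑ a, ∑ d, ∑ b, Φ a b c d := Finset.sum_comm
    _ = ∑ c, ∑ d, ∑ a, ∑ b, Φ a b c d := by
        refine Finset.sum_congr rfl fun c _ => ?_
        rw [Finset.sum_comm]

/-- [folklore] the crossed channel with the leg weight pushed inside and the quantum indices outermost:
`bubbleCrossed L L′ λ λ′ x = Σ_g Σ_f Σ_κ Σ_{κ′} Σ_i Σ_{i′} L g f λ κ i · L′ f g λ′ κ′ i′ · legWx x i i′ κ κ′`. -/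
theorem bubbleCrossed_eq_sum (L L' : CubicGerm) (lam lam' : Idx) (x : E4) :
    bubbleCrossed L L' lam lam' x = ∑ g : Idx, ∑ f : Idx, ∑ κ : Idx, ∑ κ' : Idx, ∑ i : Fin 2, ∑ i' : Fin 2,
      L g f lam κ i * L' f g lam' κ' i' * legWx x i i' κ κ' := by
  unfold bubbleCrossed
  simp only [Finset.sum_mul]
  calc ∑ i : Fin 2, ∑ i' : Fin 2, ∑ κ : Idx, ∑ κ' : Idx, ∑ g : Idx, ∑ f : Idx, L g f lam κ i * L' f g lam' κ' i' * legWx x i i' κ κ'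
      = ∑ κ : Idx, ∑ κ' : Idx, ∑ i : Fin 2, ∑ i' : Fin 2, ∑ g : Idx, ∑ f : Idx, L g f lam κ i * L' f g lam' κ' i' * legWx x i i' κ κ' :=
        sum_comm₄ (fun (i i' : Fin 2) (κ κ' : Idx) => ∑ g : Idx, ∑ f : Idx, L g f lam κ i * L' f g lam' κ' i' * legWx x i i' κ κ')
    _ = ∑ κ : Idx, ∑ κ' : Idx, ∑ g : Idx, ∑ f : Idx, ∑ i : Fin 2, ∑ i' : Fin 2, L g f lam κ i * L' f g lam' κ' i' * legWx x i i' κ κ' := by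
        refine Finset.sum_congr rfl fun κ _ => Finset.sum_congr rfl fun κ' _ => ?_
        exact sum_comm₄ (fun (i i' : Fin 2) (g f : Idx) => L g f lam κ i * L' f g lam' κ' i' * legWx x i i' κ κ')
    _ = ∑ g : Idx, ∑ f : Idx, ∑ κ : Idx, ∑ κ' : Idx, ∑ i : Fin 2, ∑ i' : Fin 2, L g f lam κ i * L' f g lam' κ' i' * legWx x i i' κ κ' :=
        sum_comm₄ (fun (κ κ' g f : Idx) => ∑ i : Fin 2, ∑ i' : Fin 2, L g f lam κ i * L' f g lam' κ' i' * legWx x i i' κ κ')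

/-- [folklore] **THE GERM OF THE LEAD IS `cL²` TIMES THE CROSSED CHANNEL**: `leadGerm cL L μ ν x = cL²·bubbleCrossed L L μ ν x` — the kernel-level trace
`tr((A∘V₀)(A∘V₁))` is ONE cyclic Wick pattern, the second germ enters with its quantum legs swapped, and the four Taylor placements are `legWx`'s. -/
theorem leadGerm_eq_crossed (cL : ℝ) (L : CubicGerm) (μ ν : Idx) (x : E4) :
    leadGerm cL L μ ν x = cL ^ 2 * bubbleCrossed L L μ ν x := by
  rw [bubbleCrossed_eq_sum, leadGerm, Finset.mul_sum]
  refine Finset.sum_congr rfl fun g _ => ?_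
  rw [Finset.mul_sum]
  refine Finset.sum_congr rfl fun f _ => ?_
  rw [← Finset.sum_neg_distrib, Finset.mul_sum]
  refine Finset.sum_congr rfl fun κ _ => ?_
  rw [← Finset.sum_neg_distrib, Finset.mul_sum]
  refine Finset.sum_congr rfl fun κ' _ => ?_
  simp only [Fin.sum_univ_two, legWx_00, legWx_01, legWx_10, legWx_11]
  ring

/-- [folklore] **BOSE**: for a germ antisymmetric under the exchange of its two quantum legs, `leadGerm cL L μ ν x = −(cL²∕2)·bubble L L μ ν x`
(`bubble = direct − crossed`, `crossed = −direct`). -/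
theorem leadGerm_eq_bubble {L : CubicGerm} (h : Anti12 L) (cL : ℝ) (μ ν : Idx) (x : E4) :
    leadGerm cL L μ ν x = -(cL ^ 2 / 2) * bubble L L μ ν x := by
  rw [leadGerm_eq_crossed, bubble, bubbleCrossed_eq_neg_direct h]
  ring

/-- [folklore] **THE LETTER `aB = ¼` (channel sign `+`)**: the germ of `hessKer`'s `−½·bubble` is `cL²·(¼·bubble L L)` for a Bose-antisymmetric germ. -/
theorem half_leadGerm {L : CubicGerm} (h : Anti12 L) (cL : ℝ) (μ ν : Idx) (x : E4) :
    -(1 / 2 : ℝ) * leadGerm cL L μ ν x = cL ^ 2 * ((1 / 4 : ℝ) * bubble L L μ ν x) := by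
  rw [leadGerm_eq_bubble h]
  ring

/-- [our object] **THE CROSSED-WEIGHT LOOP OF A SCALAR-FIBRE GERM** `l λ κ i` (ghost sector: one Wick channel, `legWx` placements):
`loopSc l λ λ′ x = Σ_{i i′ κ κ′} l λ κ i · l λ′ κ′ i′ · legWx x i i′ κ κ′`.  At `l = ghostGerm` this IS `BubbleGermValue.ghostLoop` (`loopSc_ghostGerm`, `rfl`). -/
def loopSc (l : Idx → Idx → Fin 2 → ℝ) (lam lam' : Idx) (x : E4) : ℝ :=
  ∑ i : Fin 2, ∑ i' : Fin 2, ∑ κ : Idx, ∑ κ' : Idx, l lam κ i * l lam' κ' i' * legWx x i i' κ κ'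

/-- [our object] `loopSc ghostGerm = ghostLoop` (definitional). -/
theorem loopSc_ghostGerm : loopSc ghostGerm = ghostLoop := rfl

/-- [our object] **THE GERM OF THE LEAD, SCALAR FIBRE** (`Φ = Unit`: the fibre sums are a point; moments `M₀¹_κ = l λ κ 0`, `M₀²_κ = l λ κ 1`, `M₁¹_κ = l λ′ κ 1`, `M₁²_κ = l λ′ κ 0`
through §1's scalar twins): the same four placements.  A definition asserting nothing. -/
def leadGermSc (cG : ℝ) (l : Idx → Idx → Fin 2 → ℝ) (lam lam' : Idx) (x : E4) : ℝ :=
  -(∑ κ : Idx, ∑ κ' : Idx,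
    (l lam κ 0 * l lam' κ' 1 * ((cG * invSq x) * (cG * hessInvSq κ κ' x))
      + l lam κ 0 * l lam' κ' 0 * ((cG * d1InvSq κ x) * (cG * d1InvSq κ' x))
      + l lam κ 1 * l lam' κ' 1 * ((cG * d1InvSq κ' x) * (cG * d1InvSq κ x))
      + l lam κ 1 * l lam' κ' 0 * ((cG * invSq x) * (cG * hessInvSq κ κ' x))))

/-- [folklore] **SCALAR FIBRE: THE GERM OF THE LEAD IS `cG²` TIMES THE CROSSED-WEIGHT LOOP**. -/
theorem leadGermSc_eq_loop (cG : ℝ) (l : Idx → Idx → Fin 2 → ℝ) (lam lam' : Idx) (x : E4) :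
    leadGermSc cG l lam lam' x = cG ^ 2 * loopSc l lam lam' x := by
  unfold leadGermSc loopSc
  rw [show (∑ i : Fin 2, ∑ i' : Fin 2, ∑ κ : Idx, ∑ κ' : Idx, l lam κ i * l lam' κ' i' * legWx x i i' κ κ')
      = ∑ κ : Idx, ∑ κ' : Idx, ∑ i : Fin 2, ∑ i' : Fin 2, l lam κ i * l lam' κ' i' * legWx x i i' κ κ' from
    sum_comm₄ (fun (i i' : Fin 2) (κ κ' : Idx) => l lam κ i * l lam' κ' i' * legWx x i i' κ κ'), Finset.mul_sum, ← Finset.sum_neg_distrib]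
  refine Finset.sum_congr rfl fun κ _ => ?_
  rw [Finset.mul_sum, ← Finset.sum_neg_distrib]
  refine Finset.sum_congr rfl fun κ' _ => ?_
  simp only [Fin.sum_univ_two, legWx_00, legWx_01, legWx_10, legWx_11]
  ring

/-- [folklore] scalar fibre, any germ `l`: `−½·leadGermSc cG l = cG²·(−½·loopSc l)` (one channel, no Bose doubling). -/
theorem half_leadGermSc (cG : ℝ) (l : Idx → Idx → Fin 2 → ℝ) (lam lam' : Idx) (x : E4) :
    -(1 / 2 : ℝ) * leadGermSc cG l lam lam' x = cG ^ 2 * (-(1 / 2 : ℝ) * loopSc l lam lam' x) := by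
  rw [leadGermSc_eq_loop]
  ring

/-- [folklore] **THE LETTER `aG = −½`**: the germ of `hessKer`'s `−½·bubble` in the ghost sector is `cG²·(−½·ghostLoop)` (one channel, no Bose doubling). -/
theorem half_leadGermSc_ghost (cG : ℝ) (lam lam' : Idx) (x : E4) :
    -(1 / 2 : ℝ) * leadGermSc cG ghostGerm lam lam' x = cG ^ 2 * (-(1 / 2 : ℝ) * ghostLoop lam lam' x) := by
  rw [leadGermSc_eq_loop, loopSc_ghostGerm]
  ring

end Germ

/-! ## §3 Instances and the junction with H2-ASM-4's face -/

section Instances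

/-- [folklore] the two-parameter family `c·ymGerm + s·sliceGerm`: `−½·leadGerm cL (famGerm c s) = cL²·(¼·bubble (famGerm c s) (famGerm c s))`. -/
theorem half_leadGerm_fam (cL c s : ℝ) (lam lam' : Idx) (x : E4) :
    -(1 / 2 : ℝ) * leadGerm cL (famGerm c s) lam lam' x = cL ^ 2 * ((1 / 4 : ℝ) * bubble (famGerm c s) (famGerm c s) lam lam' x) :=
  half_leadGerm (famGerm_anti12 c s) cL lam lam' x

/-- [folklore] `cQ • bfGerm` is Bose-antisymmetric under `1 ↔ 2`. -/
theorem smul_bfGerm_anti12 (cQ : ℝ) : Anti12 (cQ • bfGerm) := by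
  rw [PolarizationColour.smul_bfGerm_eq_fam]
  exact famGerm_anti12 cQ cQ

/-- [folklore] THE FACE OF H2-ASM-4: `−½·leadGerm cL (cQ • bfGerm) = cL²·(¼·bubble (cQ • bfGerm) (cQ • bfGerm))`. -/
theorem half_leadGerm_smul_bfGerm (cL cQ : ℝ) (lam lam' : Idx) (x : E4) :
    -(1 / 2 : ℝ) * leadGerm cL (cQ • bfGerm) lam lam' x = cL ^ 2 * ((1 / 4 : ℝ) * bubble (cQ • bfGerm) (cQ • bfGerm) lam lam' x) :=
  half_leadGerm (smul_bfGerm_anti12 cQ) cL lam lam' x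

/-- [folklore] the background-Feynman germ: `−½·leadGerm cL bfGerm λ λ′ x = cL²·gluonBubble λ λ′ x` (`x ≠ 0`; `= cL²·(4T − 2S)`, `quarter_bubble_bfGerm`). -/
theorem half_leadGerm_bfGerm (cL : ℝ) (lam lam' : Idx) {x : E4} (hx : x ≠ 0) :
    -(1 / 2 : ℝ) * leadGerm cL bfGerm lam lam' x = cL ^ 2 * gluonBubble lam lam' x := by
  rw [half_leadGerm bfGerm_anti12, quarter_bubble_bfGerm lam lam' hx]

/-- [folklore] the ghost sector in closed form: `−½·leadGermSc cG ghostGerm λ λ′ x = −(cG²∕2)·ghostBubble λ λ′ x` (`= −(cG²∕2)·S`, `ghostLoop_eq`). -/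
theorem half_leadGermSc_ghost' (cG : ℝ) (lam lam' : Idx) (x : E4) :
    -(1 / 2 : ℝ) * leadGermSc cG ghostGerm lam lam' x = -(cG ^ 2 / 2) * ghostBubble lam lam' x := by
  rw [half_leadGermSc_ghost, ghostLoop_eq]
  ring

/-- [folklore] **THE JUNCTION WITH H2-ASM-4**: the germ-level polarization `wg·(−½·leadGerm cL (cQ•bfGerm)) − wgh·(−½·leadGermSc cG ghostGerm)` IS `FP/PolarizationColour`'s face
`wg·cL²·(aB·bubble (cQ•bfGerm)(cQ•bfGerm)) − wgh·cG²·(aG·ghostLoop)` at `(aB, aG) = (¼, −½)`. -/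
theorem germFace_eq (wg wgh cL cG cQ : ℝ) (lam lam' : Idx) (x : E4) :
    wg * (-(1 / 2 : ℝ) * leadGerm cL (cQ • bfGerm) lam lam' x) - wgh * (-(1 / 2 : ℝ) * leadGermSc cG ghostGerm lam lam' x)
      = wg * cL ^ 2 * ((1 / 4 : ℝ) * bubble (cQ • bfGerm) (cQ • bfGerm) lam lam' x) - wgh * cG ^ 2 * (-(1 / 2 : ℝ) * ghostLoop lam lam' x) := by
  rw [half_leadGerm_smul_bfGerm, half_leadGermSc_ghost]
  ring

/-- [folklore] … hence, by `PolarizationColour.germPol_eq` at `(aB, aG) = (¼, −½)`, the germ-level polarization is `(10·wg·(cL·cQ)² + wgh·cG²∕2)∕3 · T` (`x ≠ 0`). -/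
theorem germFace_eq_transverse (wg wgh cL cG cQ : ℝ) (lam lam' : Idx) {x : E4} (hx : x ≠ 0) :
    wg * (-(1 / 2 : ℝ) * leadGerm cL (cQ • bfGerm) lam lam' x) - wgh * (-(1 / 2 : ℝ) * leadGermSc cG ghostGerm lam lam' x)
      = (10 * wg * (cL * cQ) ^ 2 + wgh * cG ^ 2 / 2) / 3 * transverse lam lam' x := by
  rw [germFace_eq, germPol_eq wg wgh (1 / 4) (-(1 / 2)) cL cG cQ lam lam' hx]
  ring

/-- [folklore] **WHAT THE LETTERS IMPLY FOR THE WEIGHTS** (a display of `PolarizationColour.weights_canonical` at `aB = ¼`, `aG = −½`; nothing asserted about an3's dictionary):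
at canonical legs `cL·cQ = c₄`, an3's two labelled sectors are matched iff `wg = 2N²` and `wgh = 4N²`. -/
theorem weights_quarter_half {cL cQ : ℝ} (hL : cL * cQ = c4) (wg wgh N : ℝ) :
    (4 * wg * (1 / 4 : ℝ) * (cL * cQ) ^ 2 = 2 * N ^ 2 * c4 ^ 2 ∧ -(wgh * (-(1 / 2 : ℝ)) * c4 ^ 2) = 2 * N ^ 2 * c4 ^ 2)
      ↔ (wg = 2 * N ^ 2 ∧ wgh = 4 * N ^ 2) := by
  rw [weights_canonical (aB := 1 / 4) (aG := -(1 / 2)) (by norm_num) (by norm_num) hL wg wgh N]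
  constructor
  · rintro ⟨h1, h2⟩; exact ⟨by rw [h1]; ring, by rw [h2]; ring⟩
  · rintro ⟨h1, h2⟩; exact ⟨by rw [h1]; ring, by rw [h2]; ring⟩

end Instances

end Summit.QuantumFields.BalabanUV.Beta.FP.PolarizationGermBubble

end
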